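import Summits.BirchSwinnertonDyer.BirchSwinnertonDyer.Theorems.CMKolyvaginAtInertTwoEvaluationSurjectiveAtTwo
import Literature.NumberTheory.EllipticCurves.HeegnerPointsKolyvaginCebotarevProofs
import HarnessLib

/-!
# Route `CMKolyvaginAtInertTwo`, crux `CMKolyvaginExactAtInertTwo` (stmt-BirchSwinnertonDyer-24277):
# McCALLUM'S COR. 3.2 / THE ČEBOTAREV LEAF OF THE KERNEL KOLYVAGIN MACHINE AT `p = 2` —
# Kolyvagin primes (Gross form, depth 1) with PRESCRIBED local behaviour of `τ`-invariant classes
# in `H¹(K, E[2])`, for `ρ̄_{E,2}` onto, `Δ_E < 0`, `Δ_E ∉ K²` (all of H₂)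

Seat `bsd-line-cmk2-p1` g3 (cell `bsd-print-cf2`); helper (`--supports stmt-BirchSwinnertonDyer-24277`;
also gk2's 22137 on its `Δ < 0` members). THEOREMS ONLY: no definition, no named fact, no `sorry`;
no item is closed; BSD is not proved by any of this. Conditional on the Čebotarev density theorem
(`Automorphic.chebotarev_artinRep`, a named fact of the tree) exactly like the odd-`p` leaf.

WHAT. The tree's `exists_kolyvaginPrime_gt` (`HeegnerPointsKolyvaginCebotarevProofs`, McCallum 1991
Prop. 3.1 / Cor. 3.2, Gross 1991 §9) is the leaf `McCallum1991_cor_3_2_eigen` of the kernel Kolyvagin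
machine: for `p` ODD, `ρ̄_{E,p}` onto, `τ`-eigenclasses `c_i ∈ H¹(K, E[p])` independent mod `p`
and prescriptions `N_i ∈ {0,1}`, there are Kolyvagin primes `ℓ > b` (Gross form (3.1)–(3.2)) with
`c_{i,λ} = 0 ⟺ N_i = 0`. Its `p ≠ 2` enters ONLY through Step A/B (the homothety `−1`, `2 ∈ (ℤ/p)ˣ`,
the `±`-eigenvectors of `τ`). This file ports the leaf to `p = 2` for `τ`-INVARIANT classes (at
`2` every eigen-sign is `+`): Step B is redone with the `p = 2` toolkit — Prop. 9.3 at `2`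
(`KolyvaginImageTwo.exists_h1Eval_eq_two`, p597299) supplies `ρ ∈ Γ_{K(E[2])}` with `[c_i, ρ] = e_i`
for the targets `e_i = 0` (`N_i = 0`) or `e_i = v` with `τv ≠ v` (`N_i = 1`; such `v` exists as
`Δ_E < 0`, g2's `KolyvaginEigenTwo.exists_twoTorsion_smul_ne_of_Δ_neg`); then for the Frobenius
`τ' = (ρm)^τ (ρm)` over `K`, `[c_i, τ'] = τe_i + e_i`, which is `0` iff `N_i = 0` (`τv + v ≠ 0`
in `E[2]` iff `τ v ≠ v`). Steps C–H (exceptional places, Čebotarev in `Γ_ℚ`, the prime `ℓ`,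
inertness, the local criterion) are the odd-`p` proof VERBATIM.

* `exists_kolyvaginPrime_gt_two` — the leaf at `p = 2` (hypotheses: `ρ̄_{E,2}` onto, `Δ_E < 0`,
  `¬ IsSquare (W⁄K).Δ`, `c_i` fixed by `conjAct W c 2`);
* `exists_kolyvaginPrime_gt_two_of_cmInert_two_of_heegner` — on H₂ hypothesis-free (`Δ < 0` and
  `Δ ∉ K²` from `CMInert W 2`, `ρ̄₂` onto, Heegner).

HONEST FRAMING. This is the «realisability» half of memo §2 (`Cruxes/CMExactDescentAtTwo/
MEMO-tau-line-at-two.md`): single Kolyvagin primes CAN be aimed at prescribed localisations of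
`τ`-invariant classes at `2`. What they cannot do (memo §1) is pair non-trivially with a
`τ`-invariant Selmer class at `λ` — that is downstream (leaf (B) / reciprocity), not this leaf.

References: [McCallumLMS1991] §3 Prop. 3.1, Cor. 3.2 (proofs); [GrossLMS1991] §3 (3.1)–(3.2), §9;
[TateGCFT1967] §2.4; [LawsonWuthrich2016] Lemma 6.
-/

-- single-conjunct summit: `Summit.BirchSwinnertonDyer.BirchSwinnertonDyer.…` repeats the name by design
set_option linter.dupNamespace false
set_option autoImplicit false

noncomputable section

open scoped Classical Pointwise IntermediateField
open WeierstrassCurve NumberField IsDedekindDomain Field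
open Literature.NumberTheory.GaloisRepresentations Literature.NumberTheory.EllipticCurves

namespace Summit.BirchSwinnertonDyer.BirchSwinnertonDyer.Theorems.KolyvaginImageTwo

/-- **McCallum's Cor. 3.2 / the Čebotarev leaf at `p = 2`, for `τ`-invariant classes.** Let `W/ℚ`
be elliptic with `ρ̄_{W,2}` onto and `Δ(W) < 0`, `K` imaginary quadratic with `Δ(W) ∉ K²`, `c` the
non-trivial automorphism of `K`, `c₁, …, c_r ∈ H¹(K, E[2])` classes FIXED by `c` and independent
mod `2`, and `N_i ∈ {0, 1}`. Granted the Čebotarev density theorem, for every bound `b` there is a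
prime `ℓ > b` with `ℓ ∤ N`, `ℓ ∤ d_K`, `ℓ ≠ 2`, `(ℓ)` prime in `𝓞_K`, `Frob(ℓ) = Frob(∞)` in
`Gal(K(E[2])/ℚ)` (`FrobEqFrobInfty W K 2 ℓ`), and `c_{i,λ} = 0 ⟺ N_i = 0` at the place `λ ∋ ℓ`.
The odd-`p` proof (`exists_kolyvaginPrime_gt`) with Step B replaced by Prop. 9.3 at `2` and a
`τ`-moved vector of `E[2]`. [cite: McCallumLMS1991, §3 Cor. 3.2 (proof, with Prop. 3.1)]
[cite: GrossLMS1991, §9 (Props. 9.3, 9.6 and the density argument)] -/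
theorem exists_kolyvaginPrime_gt_two (hC : Literature.NumberTheory.Automorphic.chebotarev_artinRep) {N : ℕ} [NeZero N]
    (W : WeierstrassCurve ℚ) [W.IsElliptic] {K : Type} [Field K] [NumberField K]
    (hK : IsImaginaryQuadratic K) (hρ : W.HasSurjectiveModNGaloisRep 2) (hΔ : W.Δ < 0)
    (hΔK : ¬ IsSquare (W.baseChange K).Δ)
    {c : K ≃ₐ[ℚ] K} (hc : c ≠ 1) {r : ℕ} (cs : Fin r → galH1Torsion (W.baseChange K) ((2 : ℕ) : ℤ))
    (hτ : ∀ i, conjAct W c ((2 : ℕ) : ℤ) (cs i) = cs i)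
    (Nv : Fin r → ℕ) (hN : ∀ i, Nv i ≤ 1)
    (hind : ∀ a : Fin r → ℤ, ∑ i, a i • cs i = 0 → ∀ i, (((2 : ℕ) : ℕ) : ℤ) ∣ a i) (b : ℕ) :
    ∃ ℓ : ℕ, b < ℓ ∧ ℓ.Prime ∧ ¬ ℓ ∣ N ∧ ¬ ((ℓ : ℤ) ∣ NumberField.discr K) ∧ ℓ ≠ 2 ∧
      (Ideal.span {(ℓ : 𝓞 K)}).IsPrime ∧ FrobEqFrobInfty W K 2 ℓ ∧
      ∀ i, ∀ v : HeightOneSpectrum (𝓞 K), (ℓ : 𝓞 K) ∈ v.asIdeal →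
        (cs i ∈ (W.baseChange K).torsionLocalKer (v.adicCompletion K) ((2 : ℕ) : ℤ) ↔ Nv i = 0) := by
  classical
  have hp : Nat.Prime 2 := Nat.prime_two
  haveI : Algebra.IsQuadraticExtension ℚ K := ⟨hK.1⟩
  haveI : IsTotallyComplex K := hK.2
  have hp0 : ((2 : ℕ) : ℤ) ≠ 0 := by norm_num
  -- ### Step A: complex conjugation, the involutive lift, a `τ`-moved `2`-torsion point
  obtain ⟨c₀, hc₀⟩ := exists_isComplexConjugation (Rat.castHom ℝ)
  set t : AlgebraicClosure K ≃+* AlgebraicClosure K :=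
    (absGaloisTransport (K := ℚ) (L := K) c₀).toRingEquiv with ht_def
  have ht : IsLiftOfAut c t :=
    RatClosure.isLiftOfAut_absGaloisTransport_of_isImaginaryQuadratic hK hc hc₀
  have hinv : ∀ x, t (t x) = x := fun x ↦
    RatClosure.absGaloisTransport_absGaloisTransport_of_sq_eq_one hc₀.sq_eq_one x
  set θ := RatClosure.torsionEquiv (K := K) W ((2 : ℕ) : ℤ) with hθ
  obtain ⟨v₀, hv₀⟩ : ∃ v : geomTorsion W ((2 : ℕ) : ℤ), c₀ • v ≠ v := by
    obtain ⟨v, hv⟩ :=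
      Summit.BirchSwinnertonDyer.BirchSwinnertonDyer.Theorems.KolyvaginEigenTwo.exists_twoTorsion_smul_ne_of_Δ_neg
        W hΔ hc₀
    exact ⟨v, hv⟩
  have hv : ht.torsionMap W ((2 : ℕ) : ℤ) (θ v₀) ≠ θ v₀ := by
    rw [← RatClosure.torsionEquiv_smul_of_lift W ht c₀ (fun _ ↦ rfl) ((2 : ℕ) : ℤ) v₀]
    exact fun h ↦ hv₀ (θ.injective h)
  -- in `E[2]`, `x + x = 0`
  have h2 : ∀ x : geomTorsion (W.baseChange K) ((2 : ℕ) : ℤ), x + x = 0 := fun x ↦ by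
    have := AddSubgroup.torsionBy.nsmul x
    rwa [two_nsmul] at this
  -- ### Step B (p = 2): the choice of `ρ` — Prop. 9.3 at `2` with targets `0` / `θ v₀`
  set e : Fin r → geomTorsion (W.baseChange K) ((2 : ℕ) : ℤ) :=
    fun i ↦ if Nv i = 0 then 0 else θ v₀ with he
  obtain ⟨ρ, hρT, hρe⟩ := exists_h1Eval_eq_two W K hK.1 hρ hΔK cs hind e
  have hρ : ∀ m ∈ evalKer (W.baseChange K) ((2 : ℕ) : ℤ) cs, ∀ i,
      h1Eval (W.baseChange K) ((2 : ℕ) : ℤ) (cs i) (ht.conjGalCMH (ρ * m) * (ρ * m)) = 0 ↔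
        Nv i = 0 := by
    intro m hm i
    have hρm : ρ * m ∈ torsionFixing (W.baseChange K) ((2 : ℕ) : ℤ) := mul_mem hρT hm.1
    have hxs : conjAct W c ((2 : ℕ) : ℤ) (cs i) = (1 : ℤ) • cs i := by rw [one_smul]; exact hτ i
    have hval : h1Eval (W.baseChange K) ((2 : ℕ) : ℤ) (cs i) (ht.conjGalCMH (ρ * m) * (ρ * m)) =
        ht.torsionMap W ((2 : ℕ) : ℤ) (e i) + e i := by
      rw [h1Eval_mul _ _ _ (ht.conjGalCMH_mem_torsionFixing W hinv _ hρm),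
        ht.h1Eval_conjGalCMH_of_eigen W hinv _ (Or.inl rfl) hxs hρm, h1Eval_mul _ _ _ hρT, hρe i,
        hm.2 i, add_zero, one_smul]
    rw [hval]
    have hNi : Nv i = 0 ∨ Nv i = 1 := by have := hN i; omega
    rcases hNi with h0 | h1
    · simp [he, h0]
    · have hei : e i = θ v₀ := by simp [he, h1]
      rw [hei]
      constructor
      · intro h
        exfalso
        apply hv
        -- `τ x + x = 0` ⟹ `τ x = -x = x`
        have := eq_neg_of_add_eq_zero_left h
        rw [this, neg_eq_of_add_eq_zero_left (h2 (θ v₀))]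
      · intro h; omega
  -- ### Step C: the finite exceptional set of places of `ℚ`
  have hbad : ((W.baseChange K).badPlaces (𝓞 K)).Finite :=
    (W.baseChange K).finite_badPlaces_holds (𝓞 K)
  choose T hTfin hT using fun i ↦
    exists_finite_forall_mem_unramifiedKer (W.baseChange K) (n := ((2 : ℕ) : ℤ)) hp0 (cs i)
  set B : Finset ℕ := {2} ∪ N.primeFactors ∪ (NumberField.discr K).natAbs.primeFactors ∪
    Finset.range (b + 1) with hB
  set S₁ : Set (HeightOneSpectrum (𝓞 ℚ)) := {v | ∃ q ∈ B, q.Prime ∧ (q : 𝓞 ℚ) ∈ v.asIdeal}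
    with hS₁
  set S₂ : Set (HeightOneSpectrum (𝓞 ℚ)) := {v | ¬ Algebra.IsUnramifiedIn (𝓞 K) v.asIdeal}
    with hS₂
  set S₃ : Set (HeightOneSpectrum (𝓞 ℚ)) :=
    (fun w : HeightOneSpectrum (𝓞 K) ↦ w.under (𝓞 ℚ)) ''
      ((W.baseChange K).badPlaces (𝓞 K) ∪ ⋃ i, T i) with hS₃
  have hS₁fin : S₁.Finite := by
    have : S₁ ⊆ ⋃ q ∈ (B.filter Nat.Prime), {v | (q : 𝓞 ℚ) ∈ v.asIdeal} := by
      intro v ⟨q, hqB, hq, hqv⟩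
      simp only [Set.mem_iUnion, Finset.mem_filter]
      exact ⟨q, ⟨hqB, hq⟩, hqv⟩
    refine Set.Finite.subset (Set.Finite.biUnion (Finset.finite_toSet _) fun q hq ↦ ?_) this
    rw [Finset.coe_filter, Set.mem_setOf_eq] at hq
    have hsub : {v : HeightOneSpectrum (𝓞 ℚ) | (q : 𝓞 ℚ) ∈ v.asIdeal}.Subsingleton :=
      fun v hv v' hv' ↦ HeightOneSpectrum.eq_of_natCast_mem_rat hq.2 hv hv'
    exact hsub.finite
  have hS₂fin : S₂.Finite := finite_setOf_not_isUnramifiedIn ℚ K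
  have hS₃fin : S₃.Finite :=
    (hbad.union (Set.finite_iUnion fun i ↦ hTfin i)).image _
  set S := S₁ ∪ S₂ ∪ S₃ with hSdef
  have hSfin : S.Finite := (hS₁fin.union hS₂fin).union hS₃fin
  -- ### Step D: Čebotarev in `Γ_ℚ`: a Frobenius in the open set `c₀ · res(ρ 𝒩)`
  set 𝒩 := evalKer (W.baseChange K) ((2 : ℕ) : ℤ) cs with h𝒩
  have h𝒩open : IsOpen (𝒩 : Set (absoluteGaloisGroup K)) :=
    isOpen_evalKer (W.baseChange K) ((2 : ℕ) : ℤ) cs (isOpen_torsionFixing (W.baseChange K) hp0)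
  set O : Set (absoluteGaloisGroup ℚ) :=
    (fun γ ↦ c₀ * γ) '' (absGaloisRestrict ℚ K '' ((fun m ↦ ρ * m) '' (𝒩 : Set _))) with hO
  have hOopen : IsOpen O := by
    refine (Homeomorph.mulLeft c₀).isOpenMap _ (isOpenMap_absGaloisRestrict K _ ?_)
    exact (Homeomorph.mulLeft ρ).isOpenMap _ h𝒩open
  have hOne : O.Nonempty :=
    ⟨c₀ * absGaloisRestrict ℚ K (ρ * 1), _, ⟨_, ⟨1, 𝒩.one_mem, rfl⟩, rfl⟩, rfl⟩
  obtain ⟨γ, hγO, v, hvS, 𝔓₀, h𝔓₀, hγ⟩ :=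
    (absoluteGaloisGroup.frobenius_dense hC ℚ S hSfin).inter_open_nonempty O hOopen hOne
  obtain ⟨_, ⟨_, ⟨m, hm, rfl⟩, rfl⟩, rfl⟩ := hγO
  set g := ρ * m with hg
  have hgT : g ∈ torsionFixing (W.baseChange K) ((2 : ℕ) : ℤ) := mul_mem hρT hm.1
  -- ### Step E: the rational prime `ℓ` under `v`
  obtain ⟨ℓ, hℓ, hℓv⟩ := exists_prime_natCast_mem v
  have hℓB : ℓ ∉ B := fun h ↦ hvS (Or.inl (Or.inl ⟨ℓ, h, hℓ, hℓv⟩))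
  simp only [hB, Finset.mem_union, Finset.mem_singleton, Nat.mem_primeFactors,
    Finset.mem_range, not_or] at hℓB
  obtain ⟨⟨⟨hℓp, hℓN⟩, hℓD⟩, hℓb⟩ := hℓB
  have hℓN' : ¬ ℓ ∣ N := fun h ↦ hℓN ⟨hℓ, h, NeZero.ne N⟩
  have hℓD' : ¬ ((ℓ : ℤ) ∣ NumberField.discr K) := fun h ↦
    hℓD ⟨hℓ, Int.natAbs_dvd_natAbs.mpr h |>.trans (by simp), by
      simp [NumberField.discr_ne_zero]⟩
  have hbℓ : b < ℓ := by omega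
  have hunr : Algebra.IsUnramifiedIn (𝓞 K) v.asIdeal := by
    by_contra h; exact hvS (Or.inl (Or.inr h))
  have hvS₃ : v ∉ S₃ := fun h ↦ hvS (Or.inr h)
  -- ### Step F: `ℓ` is inert, with a Frobenius `τ' = g^τ g` over `K`
  have hHi := index_range_absGaloisRestrict_eq_finrank ℚ K
  haveI hHn : ((absGaloisRestrict ℚ K).range).Normal :=
    Subgroup.normal_of_index_eq_two (hHi.trans hK.1)
  have hI := inertia_le_range_absGaloisRestrict_of_isUnramifiedIn (K := K) hunr h𝔓₀
  have hΦH : c₀ * absGaloisRestrict ℚ K g ∉ (absGaloisRestrict ℚ K).range := by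
    intro h
    apply hc₀.not_mem_range_absGaloisRestrict (L := K) IsTotallyComplex.isComplex
    change c₀ ∈ ((absGaloisRestrict ℚ K).range : Set (absoluteGaloisGroup ℚ))
    have h' : c₀ = c₀ * absGaloisRestrict ℚ K g * (absGaloisRestrict ℚ K g)⁻¹ := by group
    rw [SetLike.mem_coe, h']
    exact Subgroup.mul_mem _ h (Subgroup.inv_mem _ ⟨g, rfl⟩)
  obtain ⟨w, 𝔔, τ', hwv, hwuniq, -, h𝔔w, -, hτ', hresτ'⟩ :=
    exists_place_inert_of_not_mem_range (F := ℚ) (M := K) (hK.1 ▸ Nat.prime_two) hHn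
      (hHi.trans rfl) hunr h𝔓₀ hI hγ hΦH
  rw [hK.1, sq_eq_absGaloisRestrict_conjGal_mul hc₀ ht g] at hresτ'
  have hτ'eq : τ' = ht.conjGalCMH g * g := absGaloisRestrict_injective ℚ K hresτ'
  -- `ℓ ∈ w`, and `w` is the only place of `K` containing `ℓ`
  have hℓw : (ℓ : 𝓞 K) ∈ w.asIdeal := by
    have h1 : (ℓ : 𝓞 ℚ) ∈ (w.under (𝓞 ℚ)).asIdeal := by rw [hwv]; exact hℓv
    rw [HeightOneSpectrum.under_asIdeal, Ideal.under_def, Ideal.mem_comap, map_natCast] at h1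
    exact h1
  have hwuniq' : ∀ w' : HeightOneSpectrum (𝓞 K), (ℓ : 𝓞 K) ∈ w'.asIdeal → w' = w := by
    intro w' hw'
    apply hwuniq
    apply HeightOneSpectrum.eq_of_natCast_mem_rat hℓ _ hℓv
    rw [HeightOneSpectrum.under_asIdeal, Ideal.under_def, Ideal.mem_comap, map_natCast]
    exact hw'
  -- `(ℓ) = w` is prime
  have hspan : Ideal.span {(ℓ : 𝓞 K)} = w.asIdeal := by
    apply span_natCast_eq_of_unique hℓ w hwuniq'
    haveI : w.asIdeal.LiesOver v.asIdeal := ⟨by rw [← hwv]; rfl⟩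
    have hmap : v.asIdeal.map (algebraMap (𝓞 ℚ) (𝓞 K)) = Ideal.span {(ℓ : 𝓞 K)} := by
      rw [← span_natCast_rat_eq hℓ hℓv, Ideal.map_span, Set.image_singleton, map_natCast]
    have hne : v.asIdeal.map (algebraMap (𝓞 ℚ) (𝓞 K)) ≠ ⊥ := by
      rw [hmap, Ne, Ideal.span_singleton_eq_bot]; exact_mod_cast hℓ.ne_zero
    rw [← hmap, ← Ideal.IsDedekindDomain.ramificationIdx_eq_normalizedFactors_count v.asIdeal
      w.asIdeal hne]
    exact Ideal.ramificationIdx_eq_one_iff.mpr (hunr w.asIdeal w.isPrime inferInstance)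
  -- ### Step G: the local criterion at `w`
  have hloc : ∀ i, (cs i ∈ (W.baseChange K).torsionLocalKer (w.adicCompletion K) ((2 : ℕ) : ℤ) ↔
      Nv i = 0) := by
    intro i
    haveI : CharZero (w.adicCompletion K) :=
      charZero_of_injective_algebraMap (algebraMap K (w.adicCompletion K)).injective
    obtain ⟨𝔐, h𝔐⟩ := w.localPrimesAbove_nonempty
    set 𝔓w := w.primeBelow (closureEmb (K := K) (w.adicCompletion K)) 𝔐 with h𝔓w_def
    have h𝔓w : 𝔓w ∈ w.primesAbove := w.primeBelow_mem_primesAbove h𝔐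
    obtain ⟨δ, hδ, hF⟩ :=
      HeightOneSpectrum.exists_isArithFrobAt_conj_of_mem_primesAbove_holds h𝔔w h𝔓w hτ'
    have hτ'T : τ' ∈ torsionFixing (W.baseChange K) ((2 : ℕ) : ℤ) := by
      rw [hτ'eq]; exact mul_mem (ht.conjGalCMH_mem_torsionFixing W hinv _ hgT) hgT
    have hFT : δ * τ' * δ⁻¹ ∈ torsionFixing (W.baseChange K) ((2 : ℕ) : ℤ) :=
      (torsionFixing_normal (W.baseChange K) ((2 : ℕ) : ℤ)).conj_mem _ hτ'T δ
    have hwbad : w ∉ (W.baseChange K).badPlaces (𝓞 K) := fun h ↦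
      hvS₃ ⟨w, Or.inl h, hwv⟩
    have hwT : w ∉ T i := fun h ↦ hvS₃ ⟨w, Or.inr (Set.mem_iUnion.mpr ⟨i, h⟩), hwv⟩
    have hpw : ((((2 : ℕ) : ℤ)) : 𝓞 K) ∉ w.asIdeal := by
      rw [Int.cast_natCast]
      exact not_natCast_mem_of_prime_ne hℓ hp hℓp w hℓw
    have hcrit := mem_torsionLocalKer_iff_h1Eval_eq_zero (W.baseChange K) ((2 : ℕ) : ℤ) h𝔐 hF hFT
      (inertia_le_torsionFixing (W.baseChange K) hwbad hpw _ h𝔐)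
      (isOpen_torsionFixing (W.baseChange K) hp0)
      (torsionPointsMap_bijective (W.baseChange K) (w.adicCompletion K) hp.ne_zero).2
      (hT i w hwT 𝔓w h𝔓w)
    rw [hcrit, h1Eval_conj (W.baseChange K) ((2 : ℕ) : ℤ) (cs i) δ hτ'T, smul_eq_zero_iff_eq, hτ'eq]
    exact hρ m hm i
  -- ### Step H: assemble
  refine ⟨ℓ, hbℓ, hℓ, hℓN', hℓD', hℓp, hspan ▸ w.isPrime, ?_, fun i v' hv' ↦ ?_⟩
  · -- (3.2): `γ = c₀ · res g` acts on `E(ℚ̄)[p]` and on `K` as `c₀`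
    refine ⟨v, 𝔓₀, c₀ * absGaloisRestrict ℚ K g, c₀, hℓv, h𝔓₀, hγ, hc₀, fun P ↦ ?_, fun e x ↦ ?_⟩
    · rw [mul_smul, absGaloisRestrict_smul_eq_of_mem_torsionFixing W hgT]
    · rw [mul_smul, absGaloisRestrict_smul_apply_eq g e x]
  · rw [hwuniq' v' hv']
    exact hloc i

/-- **The Čebotarev leaf at `p = 2` on the habitat H₂, hypothesis-free** (but for Čebotarev): for
`W/ℚ` globally minimal with CM, `CMInert W 2`, `ρ̄_{W,2}` onto (so `Δ < 0` and `Δ ∉ K²` for every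
admissible `K`), `K` imaginary quadratic satisfying the Heegner hypothesis for `N_E`, `c ≠ 1`,
`τ`-invariant classes `c_i ∈ H¹(K, E[2])` independent mod `2` and prescriptions `N_i ≤ 1`:
Kolyvagin primes `ℓ > b` at level `N` (Gross form, depth 1) with `c_{i,λ} = 0 ⟺ N_i = 0`.
[cite: McCallumLMS1991, §3 Cor. 3.2] [cite: GrossLMS1991, §9] -/
theorem exists_kolyvaginPrime_gt_two_of_cmInert_two_of_heegner (hC : Literature.NumberTheory.Automorphic.chebotarev_artinRep)
    {N : ℕ} [NeZero N] (W : WeierstrassCurve ℚ) [W.IsElliptic] [W.IsGloballyMinimal] (hCM : W.HasCM)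
    (hin : Literature.NumberTheory.EllipticCurves.Rank1Residual.CMInert W 2)
    (hρ : W.HasSurjectiveModNGaloisRep 2) {K : Type} [Field K] [NumberField K]
    (hK : IsImaginaryQuadratic K) (hH : SatisfiesHeegnerHypothesis (W.conductorNorm ℤ) K)
    {c : K ≃ₐ[ℚ] K} (hc : c ≠ 1) {r : ℕ} (cs : Fin r → galH1Torsion (W.baseChange K) ((2 : ℕ) : ℤ))
    (hτ : ∀ i, conjAct W c ((2 : ℕ) : ℤ) (cs i) = cs i)
    (Nv : Fin r → ℕ) (hN : ∀ i, Nv i ≤ 1)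
    (hind : ∀ a : Fin r → ℤ, ∑ i, a i • cs i = 0 → ∀ i, (((2 : ℕ) : ℕ) : ℤ) ∣ a i) (b : ℕ) :
    ∃ ℓ : ℕ, b < ℓ ∧ ℓ.Prime ∧ ¬ ℓ ∣ N ∧ ¬ ((ℓ : ℤ) ∣ NumberField.discr K) ∧ ℓ ≠ 2 ∧
      (Ideal.span {(ℓ : 𝓞 K)}).IsPrime ∧ FrobEqFrobInfty W K 2 ℓ ∧
      ∀ i, ∀ v : HeightOneSpectrum (𝓞 K), (ℓ : 𝓞 K) ∈ v.asIdeal →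
        (cs i ∈ (W.baseChange K).torsionLocalKer (v.adicCompletion K) ((2 : ℕ) : ℤ) ↔ Nv i = 0) := by
  have hΔ : W.Δ < 0 :=
    Summit.BirchSwinnertonDyer.BirchSwinnertonDyer.Theorems.KolyvaginEigenTwo.Δ_neg_of_cmInert_two W hCM hin hρ
  have hΔK : ¬ IsSquare (W.baseChange K).Δ := by
    have : (W.baseChange K).Δ = algebraMap ℚ K W.Δ := by rw [baseChange, map_Δ]
    rw [this]
    exact not_isSquare_algebraMap_Δ_of_cmInert_two_of_heegner W hCM hin hρ K hK hH
  exact exists_kolyvaginPrime_gt_two hC W hK hρ hΔ hΔK hc cs hτ Nv hN hind b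

end Summit.BirchSwinnertonDyer.BirchSwinnertonDyer.Theorems.KolyvaginImageTwo

end
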